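import Literature.MathematicalPhysics.QuantumLattice.HubbardUVSymbolCTMixedDifferences
import Literature.Probability.LatticeModels.TorusFourierWeightedL1ProdMoment
import HarnessLib

/-!
# The TIME MOMENT of the scale-`0` (ultraviolet) covariance of the counterterm carrier: `(β/N)·Σ_{a,b⃗} (β/N)|ã|·‖S[G](a,b⃗)‖ ≤ T(Λ,D,R)`,
# uniform in `M`, `β`, `L`

Topic `MathematicalPhysics/QuantumLattice`; continues `HubbardUVSymbolCTMixedDifferences` (cell gate-hubbard-kl; the weighted decay constant
`α_w` of the scale-`0` step, (E4)₀ of the K3 engine, k3c2-p1's design of record).  For the character sum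
`S[G](a,b⃗) = Σ_{q₀,q⃗} χ_{q₀}(a)χ_{q⃗}(b⃗) G(q₀,q⃗)` of the padded symbol `G = gridSymbol L M N β (uvSymbolCT L M β μ K Λ) σ` on the
`N`-point time grid (`2M ≤ N`) the first TIME moment `Σ_{a,b⃗} (4|ã|/N)·‖S[G](a,b⃗)‖` (`ã ∈ (-N/2, N/2]` the signed representative) is bounded
by the weighted Plancherel inequality with a monomial (`TorusFourierWeightedL1ProdMoment.sum_sum_monomial_mul_norm_prodChar_le_prodWeight`,
`n = (1,0,0)`, `N = (1,1,1)`, product weight `(1+(ã/R₀)²)(1+(b̃₀/R)²)(1+(b̃₁/R)²)` at an integer time scale `R₀` and space scale `R`)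
against the eight `ℓ²` norms of the mixed differences `Δ_u^{1+e₀}Δ_{e₀}^{e₁}Δ_{e₁}^{e₂}G`
(`sum_norm_sq_mixedDiff_uvSymbolCT_le`).  With `R₀ = ⌈N/(βΛ)⌉` every factor of `L` cancels and the result is
`(β/N)·(β/N)·Σ_{a,b⃗} |ã|·‖S[G](a,b⃗)‖ ≤ uvTimeMomentConst Λ D R` for `2 ≤ β`, `β³ ≤ M` (the engine's thresholds) — the time part of the
weighted decay constant, in units where the grid vertex carries the weight `β/N`.

* `uvMixedSqConst`, **`sum_norm_sq_mixedDiff_uvSymbolCT_le_compact`** — `Σ‖Δ_u^aΔ^bΔ^c G‖² ≤ uvMixedSqConst/(L^{2(b+c)+2}·β^{2a+1})`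
  (`a ≤ 2`, `2 ≤ β`, `β³ ≤ M`: the edge rows are absorbed);
* **`sum_sum_timeWeight_mul_norm_charSum_le`** — the first time moment at integer scales `R₀, R ≥ 1`;
* `uvTimeMomentConst`, **`timeMoment_charSum_uvSymbolCT_le`** — the normalised, `M`-, `β`-, `L`-uniform form.

Everything is proved; the two constants are the only definitions; no named facts.

## Sources

G. Benfatto, A. Giuliani, V. Mastropietro, Ann. Henri Poincaré 7 (2006) 809–898, §2.1, Lemma 2.2, (2.36aa), §2.8 (2.80)–(2.81), (3.3)
(`BenfattoGiulianiMastropietro2006`); W. de Siqueira Pedra, M. Salmhofer, Comm. Math. Phys. 282 (2008) 797–818, §4 Cor. 4.4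
(`PedraSalmhofer2008`).
-/

noncomputable section

namespace Literature.MathematicalPhysics.QuantumLattice

open Literature.Probability.LatticeModels Literature.Analysis.SpecialFunctions Finset Complex

variable {L M N : ℕ}

/-! ### A compact majorant of the mixed-difference `ℓ²` norms: all `L` and `β` dependence explicit, the edge absorbed by `β³ ≤ M` -/

/-- **The constant of the compact majorant**: with `n = a + min(m,1) + 1`,
`Kq(a,m) = (2π)^{2(a+m)}·S_{a,m}²·(4ⁿ(2/Λ)^{2n-1} + 4a(2/Λ)^{2n}) + 2a·(2^a)²·(2π)^{2m}·S_{0,m}²/π^{2(min(m,1)+1)}`.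
[cite: BenfattoGiulianiMastropietro2006, (2.36aa)] -/
def uvMixedSqConst (Λ D : ℝ) (a m : ℕ) : ℝ :=
  (2 * Real.pi) ^ (2 * (a + m)) * uvSurfaceConst Λ D a m ^ 2 *
      (4 ^ (a + min m 1 + 1) * (2 / Λ) ^ (2 * (a + min m 1 + 1) - 1) + 4 * a * (2 / Λ) ^ (2 * (a + min m 1 + 1))) +
    2 * a * (2 ^ a) ^ 2 * (2 * Real.pi) ^ (2 * m) * uvSurfaceConst Λ D 0 m ^ 2 / Real.pi ^ (2 * (min m 1 + 1))

/-- `Kq(a,m) ≥ 0` (`0 < Λ`). [cite: BenfattoGiulianiMastropietro2006, (2.36aa)] -/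
theorem uvMixedSqConst_nonneg {Λ D : ℝ} (hΛ : 0 < Λ) (a m : ℕ) : 0 ≤ uvMixedSqConst Λ D a m := by
  unfold uvMixedSqConst; positivity

section Compact

variable [NeZero L] [NeZero N] {β μ Λ : ℝ} {K : TrigPolyC4v}

/-- **Compact majorant**: for `a ≤ 2`, `b, c ≤ 1`, `2 ≤ β`, `β³ ≤ M`, `2M ≤ N`,
`Σ_{q₀,q⃗} ‖Δ_u^a(Δ_{e_l}^bΔ_{e_{l'}}^c G)(q₀)(q⃗)‖² ≤ Kq(a,b+c)/(L^{2(b+c)+2}·β^{2a+1})` — the interior Matsubara sum is `O(β)` against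
`β^{-2-2a}`, and at the `≤ 2a` edge rows `|ω̃| ≥ πM/β ≥ πβ²`. [cite: BenfattoGiulianiMastropietro2006, Lemma 2.2 and (2.36aa)] -/
theorem sum_norm_sq_mixedDiff_uvSymbolCT_le_compact (hβ2 : 2 ≤ β) (hΛ : 0 < Λ) {D : ℝ} (hD : 0 ≤ D) (hsurf : UVSurfaceBound μ K D)
    (hβM : β ^ 3 ≤ (M : ℝ)) (hMN : 2 * M ≤ N) (σ : Fin 2) (l l' : Fin 2) {a b c : ℕ} (ha : a ≤ 2) (hb : b ≤ 1) (hc : c ≤ 1) :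
    ∑ q₀ : TorusSite 1 N, ∑ qv : TorusSite 2 L,
        ‖(fwdDiff (fun _ : Fin 1 => (1 : ZMod N)))^[a]
          (fun q => ((fwdDiff (Pi.single l (1 : ZMod L) : TorusSite 2 L))^[b]
            ((fwdDiff (Pi.single l' (1 : ZMod L) : TorusSite 2 L))^[c]
              (gridSymbol L M N β (uvSymbolCT L M β μ K Λ) σ q))) qv) q₀‖ ^ 2 ≤
      uvMixedSqConst Λ D a (b + c) / ((L : ℝ) ^ (2 * (b + c) + 2) * β ^ (2 * a + 1)) := by
  have hL : (0 : ℝ) < L := by exact_mod_cast Nat.pos_of_ne_zero (NeZero.ne L)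
  have hβ0 : 0 < β := by linarith
  have hβ1 : 1 ≤ β := by linarith
  have h8 : (2 : ℝ) ^ 3 ≤ β ^ 3 := pow_le_pow_left₀ (by norm_num) hβ2 3
  have hM8 : (8 : ℝ) ≤ M := by norm_num at h8; linarith
  have hM8' : 8 ≤ M := by exact_mod_cast hM8
  have haM : a + 1 ≤ M := by omega
  set m := b + c with hm
  set n := a + min m 1 + 1 with hn
  set k := min m 1 + 1 with hk
  set S := uvSurfaceConst Λ D a m with hS
  set S₀ := uvSurfaceConst Λ D 0 m with hS₀
  have hS0 : 0 ≤ S := uvSurfaceConst_nonneg hΛ hD a m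
  have hS₀0 : 0 ≤ S₀ := uvSurfaceConst_nonneg hΛ hD 0 m
  have hmain := sum_norm_sq_mixedDiff_uvSymbolCT_le (L := L) hβ0 hΛ hD hsurf haM hMN σ l l' hb hc
  rw [← hm] at hmain
  refine hmain.trans ?_
  have hn1 : 1 ≤ n := by omega
  -- interior term
  have hint : (L : ℝ) ^ 2 * ((1 / (β * (L : ℝ) ^ 2) * ((2 * Real.pi / β) ^ a * (2 * Real.pi / L) ^ m * S)) ^ 2 *
      (4 ^ n * ((2 / Λ) ^ (2 * n - 2) * (2 * β / Λ)) + 4 * a * (2 / Λ) ^ (2 * n))) ≤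
      (2 * Real.pi) ^ (2 * (a + m)) * S ^ 2 * (4 ^ n * (2 / Λ) ^ (2 * n - 1) + 4 * a * (2 / Λ) ^ (2 * n)) /
        ((L : ℝ) ^ (2 * m + 2) * β ^ (2 * a + 1)) := by
    have heq : (L : ℝ) ^ 2 * ((1 / (β * (L : ℝ) ^ 2) * ((2 * Real.pi / β) ^ a * (2 * Real.pi / L) ^ m * S)) ^ 2 *
        (4 ^ n * ((2 / Λ) ^ (2 * n - 2) * (2 * β / Λ)) + 4 * a * (2 / Λ) ^ (2 * n))) =
        (2 * Real.pi) ^ (2 * (a + m)) * S ^ 2 * (4 ^ n * (2 / Λ) ^ (2 * n - 1) + 4 * a * (2 / Λ) ^ (2 * n) / β) /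
          ((L : ℝ) ^ (2 * m + 2) * β ^ (2 * a + 1)) := by
      have h2n : 2 * n - 1 = (2 * n - 2) + 1 := by omega
      rw [h2n, pow_succ]
      simp only [div_pow, mul_pow, one_div]
      field_simp
      ring
    rw [heq]
    refine div_le_div_of_nonneg_right (mul_le_mul_of_nonneg_left ?_ (by positivity)) (by positivity)
    have : 4 * (a : ℝ) * (2 / Λ) ^ (2 * n) / β ≤ 4 * a * (2 / Λ) ^ (2 * n) := div_le_self (by positivity) hβ1
    linarith
  -- edge term
  have hedge : 2 * (a : ℝ) * ((L : ℝ) ^ 2 * (2 ^ a * (1 / (β * (L : ℝ) ^ 2) * ((2 * Real.pi / L) ^ m *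
      (S₀ / max (Real.pi * (2 * M - 2 * a + 1) / β) (Λ / 2) ^ k)))) ^ 2) ≤
      2 * a * (2 ^ a) ^ 2 * (2 * Real.pi) ^ (2 * m) * S₀ ^ 2 / Real.pi ^ (2 * k) / ((L : ℝ) ^ (2 * m + 2) * β ^ (2 * a + 1)) := by
    -- the extreme frequency is at least `πβ²`
    have hmx : Real.pi * β ^ 2 ≤ max (Real.pi * (2 * M - 2 * a + 1) / β) (Λ / 2) := by
      refine le_trans ?_ (le_max_left _ _)
      rw [le_div_iff₀ hβ0]
      have ha2 : (a : ℝ) ≤ 2 := by exact_mod_cast ha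
      have : β ^ 2 * β ≤ 2 * (M : ℝ) - 2 * a + 1 := by nlinarith
      nlinarith [Real.pi_pos]
    have hmx0 : 0 < Real.pi * β ^ 2 := by positivity
    have h1 : S₀ / max (Real.pi * (2 * M - 2 * a + 1) / β) (Λ / 2) ^ k ≤ S₀ / (Real.pi * β ^ 2) ^ k :=
      div_le_div_of_nonneg_left hS₀0 (pow_pos hmx0 _) (pow_le_pow_left₀ hmx0.le hmx _)
    have h2 : 2 * (a : ℝ) * ((L : ℝ) ^ 2 * (2 ^ a * (1 / (β * (L : ℝ) ^ 2) * ((2 * Real.pi / L) ^ m *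
        (S₀ / max (Real.pi * (2 * M - 2 * a + 1) / β) (Λ / 2) ^ k)))) ^ 2) ≤
        2 * a * ((L : ℝ) ^ 2 * (2 ^ a * (1 / (β * (L : ℝ) ^ 2) * ((2 * Real.pi / L) ^ m * (S₀ / (Real.pi * β ^ 2) ^ k)))) ^ 2) := by
      have h0 : 0 ≤ 2 ^ a * (1 / (β * (L : ℝ) ^ 2) * ((2 * Real.pi / L) ^ m *
          (S₀ / max (Real.pi * (2 * M - 2 * a + 1) / β) (Λ / 2) ^ k))) := by
        have := lt_max_of_lt_right (b := Real.pi * (2 * M - 2 * a + 1) / β) (show (0 : ℝ) < Λ / 2 by positivity)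
        positivity
      gcongr
    refine h2.trans ?_
    have heq : 2 * (a : ℝ) * ((L : ℝ) ^ 2 * (2 ^ a * (1 / (β * (L : ℝ) ^ 2) * ((2 * Real.pi / L) ^ m * (S₀ / (Real.pi * β ^ 2) ^ k)))) ^ 2) =
        2 * a * (2 ^ a) ^ 2 * (2 * Real.pi) ^ (2 * m) * S₀ ^ 2 / Real.pi ^ (2 * k) / ((L : ℝ) ^ (2 * m + 2) * β ^ (4 * k + 2)) := by
      have hπ := Real.pi_pos
      simp only [div_pow, mul_pow, one_div]
      field_simp
      ring
    rw [heq]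
    refine div_le_div_of_nonneg_left (by positivity) (by positivity) (mul_le_mul_of_nonneg_left ?_ (by positivity))
    exact pow_le_pow_right₀ hβ1 (by omega)
  have hsum := add_le_add hint hedge
  refine hsum.trans (le_of_eq ?_)
  rw [uvMixedSqConst, ← hn, ← hS, ← hS₀, ← hk, show 2 * m + 2 = 2 * m + 2 from rfl]
  rw [show 2 * (b + c) + 2 = 2 * m + 2 by rw [hm]]
  ring

end Compact

/-! ### The first time moment of the character sum -/

section Moment

variable [NeZero L] [NeZero N] {β μ Λ : ℝ} {K : TrigPolyC4v}

/-- **The first TIME moment at integer scales `R₀, R ≥ 1`** (`2 ≤ β`, `β³ ≤ M`, `2M ≤ N`): with `X = 4|ã|/N`,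
`Σ_{a,b⃗} X·‖S[G](a,b⃗)‖ ≤ √(216·R₀·R²)·√(N·Σ_{e∈{0,1}³} (N/(4R₀))^{2e₀}(1/(4R))^{2(e₁+e₂)}·Kq(1+e₀, e₁+e₂)/β^{2e₀+3})` — weighted Plancherel
with the monomial `X` and the product weight `(1+(ã/R₀)²)(1+(b̃₀/R)²)(1+(b̃₁/R)²)`, every `L` cancelled.
[cite: BenfattoGiulianiMastropietro2006, Lemma 2.2, (2.36aa) and (3.3)] -/
theorem sum_sum_timeWeight_mul_norm_charSum_le (hβ2 : 2 ≤ β) (hΛ : 0 < Λ) {D : ℝ} (hD : 0 ≤ D) (hsurf : UVSurfaceBound μ K D)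
    (hβM : β ^ 3 ≤ (M : ℝ)) (hMN : 2 * M ≤ N) {R₀ R : ℕ} (hR₀ : 1 ≤ R₀) (hR : 1 ≤ R) (σ : Fin 2) :
    ∑ a : TorusSite 1 N, ∑ bv : TorusSite 2 L,
        4 * |(((a 0).valMinAbs : ℤ) : ℝ)| / N *
          ‖∑ q₀ : TorusSite 1 N, ∑ qv : TorusSite 2 L,
            torusChar q₀ a * torusChar qv bv * gridSymbol L M N β (uvSymbolCT L M β μ K Λ) σ q₀ qv‖ ≤
      Real.sqrt (216 * R₀ * (R : ℝ) ^ 2) *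
        Real.sqrt ((N : ℝ) * ∑ e : Fin 2 × Fin 2 × Fin 2,
          (((N : ℝ) / (4 * R₀)) ^ 2) ^ (e.1 : ℕ) * ((1 / (4 * (R : ℝ))) ^ 2) ^ ((e.2.1 : ℕ) + (e.2.2 : ℕ)) *
            (uvMixedSqConst Λ D (1 + (e.1 : ℕ)) ((e.2.1 : ℕ) + (e.2.2 : ℕ)) / β ^ (2 * (e.1 : ℕ) + 3))) := by
  have hL : (0 : ℝ) < L := by exact_mod_cast Nat.pos_of_ne_zero (NeZero.ne L)
  have hNpos : (0 : ℝ) < N := by exact_mod_cast Nat.pos_of_ne_zero (NeZero.ne N)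
  have hβ0 : 0 < β := by linarith
  have hR0r : (0 : ℝ) < R₀ := by exact_mod_cast hR₀
  have hRr : (0 : ℝ) < R := by exact_mod_cast hR
  set G := gridSymbol L M N β (uvSymbolCT L M β μ K Λ) σ with hG
  set c₀ : ℝ := ((N : ℝ) / (4 * R₀)) ^ 2 with hc₀
  set cX : ℝ := ((L : ℝ) / (4 * R)) ^ 2 with hcX
  have hP := sum_sum_monomial_mul_norm_prodChar_le_prodWeight (d₁ := 1) (L₁ := N) (d₂ := 2) (L₂ := L) G
    (fun _ : Fin 1 => (1 : ZMod N)) (Pi.single 0 (1 : ZMod L) : TorusSite 2 L) (Pi.single 1 (1 : ZMod L) : TorusSite 2 L)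
    1 0 0 1 1 1 (c₀ := c₀) (c₁ := cX) (c₂ := cX) (by positivity) (by positivity) (by positivity)
  have h1 : ∀ a : TorusSite 1 N, (∑ j, (fun _ : Fin 1 => (1 : ZMod N)) j * a j) = a 0 := fun a => by simp
  have h2 : ∀ (i : Fin 2) (b : TorusSite 2 L), (∑ j, (Pi.single i (1 : ZMod L) : TorusSite 2 L) j * b j) = b i := by
    intro i b; simp [Pi.single_apply]
  simp only [h1, h2, pow_one, pow_zero, mul_one, zero_add] at hP
  refine hP.trans (mul_le_mul ?_ ?_ (Real.sqrt_nonneg _) (Real.sqrt_nonneg _))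
  · -- the inverse weight sum factorises: `≤ 6R₀ · 36R²`
    refine Real.sqrt_le_sqrt ?_
    have hrw : ∀ (a : TorusSite 1 N) (b : TorusSite 2 L),
        ((1 + c₀ * (4 * |((a 0).valMinAbs : ℝ)| / N) ^ (2 * 1)) *
          (1 + cX * (4 * |((b 0).valMinAbs : ℝ)| / L) ^ (2 * 1)) * (1 + cX * (4 * |((b 1).valMinAbs : ℝ)| / L) ^ (2 * 1)))⁻¹ =
          ((1 + (((a 0).valMinAbs : ℝ) / R₀) ^ 2) * ∏ i : Fin 2, (1 + (((b i).valMinAbs : ℝ) / R) ^ 2))⁻¹ := by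
      intro a b
      have hNne : (N : ℝ) ≠ 0 := hNpos.ne'
      have hLne : (L : ℝ) ≠ 0 := hL.ne'
      have hfac : ∀ (A x Rr : ℝ), Rr ≠ 0 → A ≠ 0 → (A / (4 * Rr)) ^ 2 * (4 * |x| / A) ^ (2 * 1) = (x / Rr) ^ 2 := by
        intro A x Rr hRr hA
        rw [show 2 * 1 = 2 from rfl, ← mul_pow, show A / (4 * Rr) * (4 * |x| / A) = |x| / Rr by field_simp, div_pow, sq_abs,
          ← div_pow]
      rw [Fin.prod_univ_two, hc₀, hcX, hfac _ _ _ hR0r.ne' hNne, hfac _ _ _ hRr.ne' hLne, hfac _ _ _ hRr.ne' hLne, mul_assoc]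
    simp_rw [hrw]
    rw [sum_sum_inv_prodWeight_eq_mul (fun a : TorusSite 1 N => 1 + (((a 0).valMinAbs : ℝ) / R₀) ^ 2)
      (fun b : TorusSite 2 L => ∏ i : Fin 2, (1 + (((b i).valMinAbs : ℝ) / R) ^ 2))]
    have hT : ∑ a : TorusSite 1 N, (1 + (((a 0).valMinAbs : ℝ) / R₀) ^ 2)⁻¹ ≤ 6 * (R₀ : ℝ) := by
      have h := sum_inv_one_add_valMinAbs_div_sq_le (L := N) hR₀
      simp_rw [one_div] at h
      -- `TorusSite 1 N ≃ ZMod N`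
      have he : ∑ a : TorusSite 1 N, (1 + (((a 0).valMinAbs : ℝ) / R₀) ^ 2)⁻¹ =
          ∑ x : ZMod N, (1 + ((x.valMinAbs : ℝ) / R₀) ^ 2)⁻¹ := by
        refine Fintype.sum_equiv (Equiv.funUnique (Fin 1) (ZMod N)) _ _ fun a => ?_
        simp [Equiv.funUnique]
      rw [he]; exact h
    have hX : ∑ b : TorusSite 2 L, (∏ i : Fin 2, (1 + (((b i).valMinAbs : ℝ) / R) ^ 2))⁻¹ ≤ 36 * (R : ℝ) ^ 2 := by
      have h := sum_prod_inv_one_add_valMinAbs_div_sq_le (L := L) hR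
      refine le_trans (le_of_eq (sum_congr rfl fun b _ => ?_)) h
      rw [Finset.prod_inv_distrib]
    have hT0 : 0 ≤ ∑ a : TorusSite 1 N, (1 + (((a 0).valMinAbs : ℝ) / R₀) ^ 2)⁻¹ := sum_nonneg fun a _ => by positivity
    calc (∑ a : TorusSite 1 N, (1 + (((a 0).valMinAbs : ℝ) / R₀) ^ 2)⁻¹) *
          ∑ b : TorusSite 2 L, (∏ i : Fin 2, (1 + (((b i).valMinAbs : ℝ) / R) ^ 2))⁻¹
        ≤ (6 * (R₀ : ℝ)) * (36 * (R : ℝ) ^ 2) := mul_le_mul hT hX (sum_nonneg fun b _ => by positivity) (by positivity)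
      _ = 216 * R₀ * (R : ℝ) ^ 2 := by ring
  · -- the eight mixed `ℓ²` norms
    refine Real.sqrt_le_sqrt ?_
    rw [mul_assoc]
    refine mul_le_mul_of_nonneg_left ?_ (by positivity)
    rw [mul_sum]
    refine sum_le_sum fun e _ => ?_
    have he1 : (e.1 : ℕ) ≤ 1 := Nat.lt_succ_iff.1 e.1.isLt
    have he21 : (e.2.1 : ℕ) ≤ 1 := Nat.lt_succ_iff.1 e.2.1.isLt
    have he22 : (e.2.2 : ℕ) ≤ 1 := Nat.lt_succ_iff.1 e.2.2.isLt
    have hq := sum_norm_sq_mixedDiff_uvSymbolCT_le_compact (L := L) hβ2 hΛ hD hsurf hβM hMN σ 0 1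
      (a := 1 + (e.1 : ℕ) * 1) (b := 0 + (e.2.1 : ℕ) * 1) (c := 0 + (e.2.2 : ℕ) * 1) (by omega) (by omega) (by omega)
    have hK0 := uvMixedSqConst_nonneg (D := D) hΛ (1 + (e.1 : ℕ)) ((e.2.1 : ℕ) + (e.2.2 : ℕ))
    simp only [mul_one, zero_add] at hq
    calc (L : ℝ) ^ 2 * (c₀ ^ (e.1 : ℕ) * cX ^ (e.2.1 : ℕ) * cX ^ (e.2.2 : ℕ) *
          ∑ p : TorusSite 1 N, ∑ p' : TorusSite 2 L,
            ‖(fwdDiff (fun _ : Fin 1 => (1 : ZMod N)))^[1 + (e.1 : ℕ)]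
              (fun q => ((fwdDiff (Pi.single 0 (1 : ZMod L) : TorusSite 2 L))^[(e.2.1 : ℕ)]
                ((fwdDiff (Pi.single 1 (1 : ZMod L) : TorusSite 2 L))^[(e.2.2 : ℕ)] (G q))) p') p‖ ^ 2)
        ≤ (L : ℝ) ^ 2 * (c₀ ^ (e.1 : ℕ) * cX ^ (e.2.1 : ℕ) * cX ^ (e.2.2 : ℕ) *
          (uvMixedSqConst Λ D (1 + (e.1 : ℕ)) ((e.2.1 : ℕ) + (e.2.2 : ℕ)) /
            ((L : ℝ) ^ (2 * ((e.2.1 : ℕ) + (e.2.2 : ℕ)) + 2) * β ^ (2 * (1 + (e.1 : ℕ)) + 1)))) := by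
          gcongr
      _ = c₀ ^ (e.1 : ℕ) * ((1 / (4 * (R : ℝ))) ^ 2) ^ ((e.2.1 : ℕ) + (e.2.2 : ℕ)) *
          (uvMixedSqConst Λ D (1 + (e.1 : ℕ)) ((e.2.1 : ℕ) + (e.2.2 : ℕ)) / β ^ (2 * (e.1 : ℕ) + 3)) := by
          rw [show 2 * (1 + (e.1 : ℕ)) + 1 = 2 * (e.1 : ℕ) + 3 by ring]
          obtain ⟨e0, e1, e2⟩ := e
          fin_cases e0 <;> fin_cases e1 <;> fin_cases e2 <;> simp [hcX] <;> field_simp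

end Moment

/-! ### The normalised, uniform form -/

/-- **The time-moment constant** `T(Λ,D,R) = ¼·√(216R²(1/Λ + 1/2))·√(Σ_e (Λ/4)^{2e₀}(1/(4R))^{2(e₁+e₂)}·Kq(1+e₀,e₁+e₂))` (depends on
`Λ, D, R` only). [cite: BenfattoGiulianiMastropietro2006, (2.36aa)] -/
def uvTimeMomentConst (Λ D : ℝ) (R : ℕ) : ℝ :=
  1 / 4 * Real.sqrt (216 * (R : ℝ) ^ 2 * (1 / Λ + 1 / 2)) *
    Real.sqrt (∑ e : Fin 2 × Fin 2 × Fin 2, ((Λ / 4) ^ 2) ^ (e.1 : ℕ) * ((1 / (4 * (R : ℝ))) ^ 2) ^ ((e.2.1 : ℕ) + (e.2.2 : ℕ)) *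
      uvMixedSqConst Λ D (1 + (e.1 : ℕ)) ((e.2.1 : ℕ) + (e.2.2 : ℕ)))

section Uniform

variable [NeZero L] [NeZero N] {β μ Λ : ℝ} {K : TrigPolyC4v}

/-- **The time moment of the scale-`0` covariance is `O(1)` in the grid units** (`2 ≤ β`, `0 < Λ`, `β³ ≤ M`, `2M ≤ N`, `R ≥ 1`):
`(β/N)·Σ_{a,b⃗} (β/N)|ã|·‖S[G](a,b⃗)‖ ≤ uvTimeMomentConst Λ D R` — choose `R₀ = ⌈N/(βΛ)⌉` in `sum_sum_timeWeight_mul_norm_charSum_le`;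
then `(N/(4R₀))²/β² ≤ (Λ/4)²`, `6R₀ ≤ 6(N/(βΛ) + 1)` and `β/N ≤ 1/2`. [cite: BenfattoGiulianiMastropietro2006, §2.8 (2.80)–(2.81)] -/
theorem timeMoment_charSum_uvSymbolCT_le (hβ2 : 2 ≤ β) (hΛ : 0 < Λ) {D : ℝ} (hD : 0 ≤ D) (hsurf : UVSurfaceBound μ K D)
    (hβM : β ^ 3 ≤ (M : ℝ)) (hMN : 2 * M ≤ N) {R : ℕ} (hR : 1 ≤ R) (σ : Fin 2) :
    β / N * ∑ a : TorusSite 1 N, ∑ bv : TorusSite 2 L,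
        β / N * |(((a 0).valMinAbs : ℤ) : ℝ)| *
          ‖∑ q₀ : TorusSite 1 N, ∑ qv : TorusSite 2 L,
            torusChar q₀ a * torusChar qv bv * gridSymbol L M N β (uvSymbolCT L M β μ K Λ) σ q₀ qv‖ ≤
      uvTimeMomentConst Λ D R := by
  have hNpos : (0 : ℝ) < N := by exact_mod_cast Nat.pos_of_ne_zero (NeZero.ne N)
  have hβ0 : 0 < β := by linarith
  have hRr : (0 : ℝ) < R := by exact_mod_cast hR
  -- `β/N ≤ 1/2`
  have hβN : β / N ≤ 1 / 2 := by
    rw [div_le_iff₀ hNpos]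
    have hM : (M : ℝ) ≥ β ^ 3 := hβM
    have hN2 : (2 * M : ℝ) ≤ N := by exact_mod_cast hMN
    nlinarith [sq_nonneg β]
  -- the time scale
  set R₀ : ℕ := ⌈(N : ℝ) / (β * Λ)⌉₊ with hR₀
  have hR₀pos : (0 : ℝ) < (N : ℝ) / (β * Λ) := by positivity
  have hR₀1 : 1 ≤ R₀ := Nat.one_le_iff_ne_zero.2 (Nat.ceil_pos.2 hR₀pos).ne'
  have hR₀le : (N : ℝ) / (β * Λ) ≤ R₀ := Nat.le_ceil _
  have hR₀lt : (R₀ : ℝ) < (N : ℝ) / (β * Λ) + 1 := Nat.ceil_lt_add_one hR₀pos.le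
  have hR₀r : (0 : ℝ) < R₀ := by exact_mod_cast hR₀1
  have hT := sum_sum_timeWeight_mul_norm_charSum_le (L := L) hβ2 hΛ hD hsurf hβM hMN hR₀1 hR σ
  -- rewrite the left-hand side as `(β/N)·(β/4)·Σ X‖S‖`
  have hlhs : β / N * ∑ a : TorusSite 1 N, ∑ bv : TorusSite 2 L,
      β / N * |(((a 0).valMinAbs : ℤ) : ℝ)| *
        ‖∑ q₀ : TorusSite 1 N, ∑ qv : TorusSite 2 L,
          torusChar q₀ a * torusChar qv bv * gridSymbol L M N β (uvSymbolCT L M β μ K Λ) σ q₀ qv‖ =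
      β / N * (β / 4) * ∑ a : TorusSite 1 N, ∑ bv : TorusSite 2 L,
        4 * |(((a 0).valMinAbs : ℤ) : ℝ)| / N *
          ‖∑ q₀ : TorusSite 1 N, ∑ qv : TorusSite 2 L,
            torusChar q₀ a * torusChar qv bv * gridSymbol L M N β (uvSymbolCT L M β μ K Λ) σ q₀ qv‖ := by
    simp only [Finset.mul_sum]
    refine Finset.sum_congr rfl fun a _ => Finset.sum_congr rfl fun bv _ => ?_
    ring
  rw [hlhs]
  -- bound the two square roots
  set KT := ∑ e : Fin 2 × Fin 2 × Fin 2, ((Λ / 4) ^ 2) ^ (e.1 : ℕ) * ((1 / (4 * (R : ℝ))) ^ 2) ^ ((e.2.1 : ℕ) + (e.2.2 : ℕ)) *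
    uvMixedSqConst Λ D (1 + (e.1 : ℕ)) ((e.2.1 : ℕ) + (e.2.2 : ℕ)) with hKT
  have hKT0 : 0 ≤ KT := sum_nonneg fun e _ => by
    have := uvMixedSqConst_nonneg (D := D) hΛ (1 + (e.1 : ℕ)) ((e.2.1 : ℕ) + (e.2.2 : ℕ)); positivity
  have hS2 : (N : ℝ) * ∑ e : Fin 2 × Fin 2 × Fin 2,
      (((N : ℝ) / (4 * R₀)) ^ 2) ^ (e.1 : ℕ) * ((1 / (4 * (R : ℝ))) ^ 2) ^ ((e.2.1 : ℕ) + (e.2.2 : ℕ)) *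
        (uvMixedSqConst Λ D (1 + (e.1 : ℕ)) ((e.2.1 : ℕ) + (e.2.2 : ℕ)) / β ^ (2 * (e.1 : ℕ) + 3)) ≤ (N : ℝ) / β ^ 3 * KT := by
    rw [hKT, mul_sum, mul_sum]
    refine sum_le_sum fun e _ => ?_
    have hK0 := uvMixedSqConst_nonneg (D := D) hΛ (1 + (e.1 : ℕ)) ((e.2.1 : ℕ) + (e.2.2 : ℕ))
    -- `(N/(4R₀))²/β² ≤ (Λ/4)²`
    have hc : ((N : ℝ) / (4 * R₀)) ^ 2 / β ^ 2 ≤ (Λ / 4) ^ 2 := by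
      rw [← div_pow, div_div]
      refine pow_le_pow_left₀ (by positivity) ?_ 2
      rw [div_le_div_iff₀ (by positivity) (by norm_num)]
      have : (N : ℝ) ≤ R₀ * (β * Λ) := by rwa [div_le_iff₀ (by positivity)] at hR₀le
      nlinarith
    have heq : (N : ℝ) * ((((N : ℝ) / (4 * R₀)) ^ 2) ^ (e.1 : ℕ) * ((1 / (4 * (R : ℝ))) ^ 2) ^ ((e.2.1 : ℕ) + (e.2.2 : ℕ)) *
        (uvMixedSqConst Λ D (1 + (e.1 : ℕ)) ((e.2.1 : ℕ) + (e.2.2 : ℕ)) / β ^ (2 * (e.1 : ℕ) + 3))) =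
        (N : ℝ) / β ^ 3 * ((((N : ℝ) / (4 * R₀)) ^ 2 / β ^ 2) ^ (e.1 : ℕ) * ((1 / (4 * (R : ℝ))) ^ 2) ^ ((e.2.1 : ℕ) + (e.2.2 : ℕ)) *
          uvMixedSqConst Λ D (1 + (e.1 : ℕ)) ((e.2.1 : ℕ) + (e.2.2 : ℕ))) := by
      have hb : β ^ (2 * (e.1 : ℕ) + 3) = (β ^ 2) ^ (e.1 : ℕ) * β ^ 3 := by rw [pow_add, pow_mul]
      rw [hb, div_pow _ (β ^ 2)]
      field_simp
    rw [heq]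
    refine mul_le_mul_of_nonneg_left ?_ (by positivity)
    gcongr
  have hS1 : 216 * (R₀ : ℝ) * (R : ℝ) ^ 2 ≤ 216 * (R : ℝ) ^ 2 * ((N : ℝ) / (β * Λ) + 1) := by nlinarith [hR₀lt.le]
  have hsq := mul_le_mul (Real.sqrt_le_sqrt hS1) (Real.sqrt_le_sqrt hS2) (Real.sqrt_nonneg _) (Real.sqrt_nonneg _)
  have hfin : β / N * (β / 4) * (Real.sqrt (216 * (R : ℝ) ^ 2 * ((N : ℝ) / (β * Λ) + 1)) * Real.sqrt ((N : ℝ) / β ^ 3 * KT)) ≤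
      uvTimeMomentConst Λ D R := by
    -- `(β/N)(β/4)·√A·√B = ¼·√(216R²(1/Λ + β/N))·√KT` since `A·B = (N/β²)²·216R²(1/Λ + β/N)·KT`
    set A : ℝ := 216 * (R : ℝ) ^ 2 * ((N : ℝ) / (β * Λ) + 1) with hAdef
    set C : ℝ := 216 * (R : ℝ) ^ 2 * (1 / Λ + β / N) with hCdef
    have hA0 : 0 ≤ A := by positivity
    have hAB : A * ((N : ℝ) / β ^ 3 * KT) = ((N : ℝ) / β ^ 2) ^ 2 * (C * KT) := by
      rw [hAdef, hCdef]; field_simp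
    have h1 : β / N * (β / 4) * (Real.sqrt A * Real.sqrt ((N : ℝ) / β ^ 3 * KT)) = 1 / 4 * Real.sqrt C * Real.sqrt KT := by
      rw [← Real.sqrt_mul hA0, hAB, Real.sqrt_mul (sq_nonneg _), Real.sqrt_sq (by positivity), Real.sqrt_mul (by positivity)]
      field_simp
    rw [h1, uvTimeMomentConst, ← hKT, hCdef]
    gcongr
  exact le_trans (mul_le_mul_of_nonneg_left (hT.trans hsq) (by positivity)) hfin

end Uniform

end Literature.MathematicalPhysics.QuantumLattice

end
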